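import Summits.NavierStokesRegularity.NavierStokesRegularity.Theses.RellichScar
import Literature.Analysis.FluidPDE.LocalTypeISlabProfile
import Literature.Analysis.FluidPDE.LocalTypeICharacterization
import Literature.Analysis.FluidPDE.LocalTypeILiouville

/-!
# `SymmetricScarExists` (crux stmt-NavierStokesRegularity-11718, route RellichScar): the crux, the
# target and six siblings versus `LocalTypeISingularityExists` — negative-side support (cdisprove seat)

Barrier certificate of the crux disprover.  By the packaging theorem
`Literature.Analysis.FluidPDE.localTypeISingularityExists_of_slabProfile` (`LocalTypeISlabProfile.lean`:
a suitable weak solution on the slab `ℝ³ × (−∞,0)` with a weak gradient, Albritton–Barker quantity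
`𝐈 < ∞` and a backward-singular origin is, after normalising the pressure, a local Type I singular
point in the printed sense of Albritton–Barker 2019, Thm 1.1), proved here `sorry`-free:

* `localTypeISingularityExists_of_not_symmetricScarExists` — any refutation of the crux is a witness
  of the registered OPEN statement `LocalTypeISingularityExists` (A–B Thm 1.1, first bullet;
  expected FALSE under the KNSS Liouville conjecture (L));
* `symmetricScarExists_of_not_localTypeISingularityExists` and the analogues for the target
  `NoApexTypeIProfile`, the sibling cruxes `ScarRigidity`, `ApexLocalisation` and the supports
  `SimilarityCovariance`, `SelfSimilarApexFatal`, `AxisymmetricApexFatal`, `NoMildScar`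
  (`route_newItems_of_not_localTypeISingularityExists`): the eight items of the route that quantify
  over a singular slab profile are JOINTLY corollaries of `¬ LocalTypeISingularityExists`;
* KNSS language: modulo the named fact `AlbrittonBarkerForward` a refutation of the crux gives
  `NontrivialMildAncientTypeIExists` (a Type-I blow-up profile); adding `LiouvilleConjectureNS` the
  witness must have a NON-measurable slice (`exists_nonmeasurable_witness_of_not_symmetricScarExists`),
  and conversely (`symmetricScarExists_of_liouville`).

## References

* D. Albritton, T. Barker, J. Math. Fluid Mech. 21 (2019) = arXiv:1811.00502, Thm 1.1, §1. [AlbrittonBarker2019]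
* G. Koch, N. Nadirashvili, G. Seregin, V. Šverák, Acta Math. 203 (2009), §1, conjecture (L). [KNSS2009]
-/

noncomputable section

open MeasureTheory Set Function Filter Topology TopologicalSpace Metric
open scoped NNReal ENNReal

namespace Summit.NavierStokesRegularity.NavierStokesRegularity.Theorems.SymmetricScarExists.Negative

open Literature.Analysis.FluidPDE
open Summit.NavierStokesRegularity.NavierStokesRegularity.Theses.RellichScar

section Barrier

/-- **Refuting the crux constructs a Type-I singularity.**  `¬ SymmetricScarExists` yields the
antecedent's singular apex profile, which §1 packages into `LocalTypeISingularityExists`.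
[cite: AlbrittonBarker2019, Thm 1.1] -/
theorem localTypeISingularityExists_of_not_symmetricScarExists (h : ¬ SymmetricScarExists) :
    LocalTypeISingularityExists := by
  by_contra hno
  refine h fun C hex => ?_
  obtain ⟨u, p, G, hsw, hwg, hI, -, hsing⟩ := hex
  exact absurd (localTypeISingularityExists_of_slabProfile hsw hwg hI hsing) hno

/-- **The crux holds in the (L)-world**: if no suitable weak solution has a local Type I singular
point (`¬ LocalTypeISingularityExists`, e.g. under the Liouville conjecture via A–B Thm 1.1), then
`SymmetricScarExists` holds — vacuously, its antecedent class being empty. [cite: AlbrittonBarker2019, §1] -/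
theorem symmetricScarExists_of_not_localTypeISingularityExists (hno : ¬ LocalTypeISingularityExists) :
    SymmetricScarExists := by
  by_contra h
  exact hno (localTypeISingularityExists_of_not_symmetricScarExists h)

/-- The route's TARGET `X = NoApexTypeIProfile` is likewise a corollary of
`¬ LocalTypeISingularityExists` (the apex decay is not even needed). [cite: AlbrittonBarker2019, Thm 1.1] -/
theorem noApexTypeIProfile_of_not_localTypeISingularityExists (hno : ¬ LocalTypeISingularityExists) :
    NoApexTypeIProfile :=
  fun _ _ _ _ hsw hwg hI _ hsing => hno (localTypeISingularityExists_of_slabProfile hsw hwg hI hsing)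

/-- Conversely a failure of the target is a Type-I singularity in the A–B sense. [cite: AlbrittonBarker2019, Thm 1.1] -/
theorem localTypeISingularityExists_of_not_noApexTypeIProfile (h : ¬ NoApexTypeIProfile) :
    LocalTypeISingularityExists := by
  by_contra hno
  exact h (noApexTypeIProfile_of_not_localTypeISingularityExists hno)

/-- Sibling crux `ScarRigidity` (stmt-11717) is a corollary of `¬ LocalTypeISingularityExists`
(its hypotheses contain a singular slab profile with `𝐈 < ∞`). [cite: AlbrittonBarker2019, Thm 1.1] -/
theorem scarRigidity_of_not_localTypeISingularityExists (hno : ¬ LocalTypeISingularityExists) :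
    ScarRigidity :=
  fun _ _ _ _ _ _ _ hs₁ hg₁ hI₁ _ _ _ _ _ hsing₁ _ _ =>
    absurd (localTypeISingularityExists_of_slabProfile hs₁ hg₁ hI₁ hsing₁) hno

/-- Sibling crux `ApexLocalisation` (stmt-11719) is a corollary of `¬ LocalTypeISingularityExists`
(its antecedent is a singular RATE-class slab profile with `𝐈 < ∞`; the rate is not needed either).
[cite: AlbrittonBarker2019, Thm 1.1] -/
theorem apexLocalisation_of_not_localTypeISingularityExists (hno : ¬ LocalTypeISingularityExists) :
    ApexLocalisation := by
  intro C hex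
  obtain ⟨u, p, G, hsw, hwg, hI, -, hsing⟩ := hex
  exact absurd (localTypeISingularityExists_of_slabProfile hsw hwg hI hsing) hno

/-- Support `SimilarityCovariance` (stmt-11720) is a corollary of `¬ LocalTypeISingularityExists`.
[cite: AlbrittonBarker2019, Thm 1.1] -/
theorem similarityCovariance_of_not_localTypeISingularityExists (hno : ¬ LocalTypeISingularityExists) :
    SimilarityCovariance :=
  fun _ _ _ _ hsw hwg hI _ hsing =>
    absurd (localTypeISingularityExists_of_slabProfile hsw hwg hI hsing) hno

/-- Support `SelfSimilarApexFatal` (stmt-11721) is a corollary of `¬ LocalTypeISingularityExists`.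
[cite: AlbrittonBarker2019, Thm 1.1] -/
theorem selfSimilarApexFatal_of_not_localTypeISingularityExists (hno : ¬ LocalTypeISingularityExists) :
    SelfSimilarApexFatal :=
  fun _ _ _ _ hsw hwg hI _ hsing _ => hno (localTypeISingularityExists_of_slabProfile hsw hwg hI hsing)

/-- Support `AxisymmetricApexFatal` (stmt-11722) is a corollary of `¬ LocalTypeISingularityExists`.
[cite: AlbrittonBarker2019, Thm 1.1] -/
theorem axisymmetricApexFatal_of_not_localTypeISingularityExists (hno : ¬ LocalTypeISingularityExists) :
    AxisymmetricApexFatal :=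
  fun _ _ _ _ hsw hwg hI _ hsing _ => hno (localTypeISingularityExists_of_slabProfile hsw hwg hI hsing)

/-- Support `NoMildScar` (stmt-11723) is a corollary of `¬ LocalTypeISingularityExists`.
[cite: AlbrittonBarker2019, Thm 1.1] -/
theorem noMildScar_of_not_localTypeISingularityExists (hno : ¬ LocalTypeISingularityExists) :
    NoMildScar :=
  fun _ _ _ _ hsw hwg hI _ hsing _ _ _ _ _ =>
    hno (localTypeISingularityExists_of_slabProfile hsw hwg hI hsing)

/-- **Summary of §2.**  The eight items of route RellichScar that quantify over a singular slab
profile — target, the three non-shared cruxes and four supports — are JOINTLY implied by the single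
statement `¬ LocalTypeISingularityExists` (negation of A–B Thm 1.1's first bullet, the registered
open statement other Type-I routes attack directly, e.g. `TypeICertificateLadder`), and the failure
of either the crux or the target implies that bullet. [cite: AlbrittonBarker2019, Thm 1.1] -/
theorem route_newItems_of_not_localTypeISingularityExists (hno : ¬ LocalTypeISingularityExists) :
    NoApexTypeIProfile ∧ ScarRigidity ∧ SymmetricScarExists ∧ ApexLocalisation ∧
      SimilarityCovariance ∧ SelfSimilarApexFatal ∧ AxisymmetricApexFatal ∧ NoMildScar :=
  ⟨noApexTypeIProfile_of_not_localTypeISingularityExists hno,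
    scarRigidity_of_not_localTypeISingularityExists hno,
    symmetricScarExists_of_not_localTypeISingularityExists hno,
    apexLocalisation_of_not_localTypeISingularityExists hno,
    similarityCovariance_of_not_localTypeISingularityExists hno,
    selfSimilarApexFatal_of_not_localTypeISingularityExists hno,
    axisymmetricApexFatal_of_not_localTypeISingularityExists hno,
    noMildScar_of_not_localTypeISingularityExists hno⟩

end Barrier

/-! ## §3 The same barrier in KNSS language: Type-I blow-up profiles and the Liouville conjecture (L) -/

section KNSS

/-- **Refuting the crux produces a KNSS Type-I blow-up profile** (modulo the forward half of
Albritton–Barker 2019, Thm 1.1, vendored as the named fact `AlbrittonBarkerForward`): a non-trivial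
mild bounded ancient solution with `𝐈 < ∞` (`NontrivialMildAncientTypeIExists`, the registered OPEN
second bullet of A–B Thm 1.1 — "In principle, constructing ancient solutions with Type I decay is a
(difficult) route to obtaining Navier–Stokes singularities", A–B §1). [cite: AlbrittonBarker2019, Thm 1.1 and §1] -/
theorem nontrivialMildAncientTypeIExists_of_not_symmetricScarExists (hfwd : AlbrittonBarkerForward)
    (h : ¬ SymmetricScarExists) : NontrivialMildAncientTypeIExists :=
  hfwd (localTypeISingularityExists_of_not_symmetricScarExists h)

/-- **Under (L), a refutation of the crux can only come with a measurability pathology.**  Assume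
the forward half of A–B Thm 1.1 and the Liouville conjecture `LiouvilleConjectureNS` (KNSS 2009:
bounded ancient mild solutions with measurable slices are constant).  Then any refutation of
`SymmetricScarExists` yields a witness `(u, p, G)` of `NontrivialMildAncientTypeIExists` one of whose
slices `u t`, `t < 0`, is NOT a.e.-strongly measurable — the known gap of the accepted duality-form
class `IsBoundedAncientMildSolution` (tree `LocalTypeILiouville.lean`), not a fluid-mechanical
object.  In the (L)-world the crux is therefore refutable only "for the wrong reason", and that
reason sits two named facts away from the crux (A–B forward; the slice-measurability proviso).
[cite: AlbrittonBarker2019, §1 after Thm 1.1; KNSS2009, §1] -/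
theorem exists_nonmeasurable_witness_of_not_symmetricScarExists (hfwd : AlbrittonBarkerForward)
    (hL : LiouvilleConjectureNS) (h : ¬ SymmetricScarExists) :
    ∃ (u : ℝ → (EuclideanSpace ℝ (Fin 3)) → (EuclideanSpace ℝ (Fin 3))) (p : ℝ → (EuclideanSpace ℝ (Fin 3)) → ℝ) (G : ℝ → (EuclideanSpace ℝ (Fin 3)) → (EuclideanSpace ℝ (Fin 3)) →L[ℝ] (EuclideanSpace ℝ (Fin 3))),
      Literature.Analysis.FluidPDE.IsBoundedAncientMildSolution 1 u ∧
      IsSuitableWeakSolutionOn (slab (EuclideanSpace ℝ (Fin 3)) (Iio (0 : ℝ)) isOpen_Iio) 1 0 u p ∧ HasWeakSpatialGradientOn (slab (EuclideanSpace ℝ (Fin 3)) (Iio (0 : ℝ)) isOpen_Iio) u G ∧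
      ¬ (uncurry u =ᵐ[volume.restrict (Iio (0 : ℝ) ×ˢ (univ : Set (EuclideanSpace ℝ (Fin 3))))] 0) ∧
      typeIBound (Iio (0 : ℝ) ×ˢ (univ : Set (EuclideanSpace ℝ (Fin 3)))) u p G < ∞ ∧
      ∃ t < 0, ¬ AEStronglyMeasurable (u t) volume := by
  obtain ⟨u, p, G, hu, hs, hG, hne, hI⟩ :=
    nontrivialMildAncientTypeIExists_of_not_symmetricScarExists hfwd h
  exact ⟨u, p, G, hu, hs, hG, hne, hI,
    hL.exists_not_aestronglyMeasurable_slice_of_abTypeIBound hu hG hne hI⟩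

/-- Contrapositive packaging: (L) + A–B forward + "every bounded ancient mild solution arising
this way has measurable slices" ⇒ the crux.  The measurability clause is stated as a hypothesis on
the witnesses of `NontrivialMildAncientTypeIExists` (it holds for the KNSS representatives, which
are smooth; the accepted class does not record it). [cite: KNSS2009, §1; AlbrittonBarker2019, §1] -/
theorem symmetricScarExists_of_liouville (hfwd : AlbrittonBarkerForward) (hL : LiouvilleConjectureNS)
    (hmeas : ∀ (u : ℝ → (EuclideanSpace ℝ (Fin 3)) → (EuclideanSpace ℝ (Fin 3))) (p : ℝ → (EuclideanSpace ℝ (Fin 3)) → ℝ) (G : ℝ → (EuclideanSpace ℝ (Fin 3)) → (EuclideanSpace ℝ (Fin 3)) →L[ℝ] (EuclideanSpace ℝ (Fin 3))),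
      Literature.Analysis.FluidPDE.IsBoundedAncientMildSolution 1 u →
      IsSuitableWeakSolutionOn (slab (EuclideanSpace ℝ (Fin 3)) (Iio (0 : ℝ)) isOpen_Iio) 1 0 u p → HasWeakSpatialGradientOn (slab (EuclideanSpace ℝ (Fin 3)) (Iio (0 : ℝ)) isOpen_Iio) u G →
      typeIBound (Iio (0 : ℝ) ×ˢ (univ : Set (EuclideanSpace ℝ (Fin 3)))) u p G < ∞ →
      ∀ t < 0, AEStronglyMeasurable (u t) volume) :
    SymmetricScarExists := by
  by_contra h
  obtain ⟨u, p, G, hu, hs, hG, -, hI, t, ht, hnot⟩ :=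
    exists_nonmeasurable_witness_of_not_symmetricScarExists hfwd hL h
  exact hnot (hmeas u p G hu hs hG hI t ht)

end KNSS

end Summit.NavierStokesRegularity.NavierStokesRegularity.Theorems.SymmetricScarExists.Negative
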